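import Literature.Probability.LatticeModels.DiscreteGFFSiteFlip
import HarnessLib

/-!
# Flipping the sign of a Gaussian lattice field on a finite set of sites

Topic `Literature/Probability/LatticeModels`; continuation of `DiscreteGFFSiteFlip.lean`. If the
centred Gaussian lattice field `X` on `(Ω, P)` has the innovation property (`IsInnovationSite`)
at every site of a finite set `S ⊆ ℤ^d`, then flipping the sign of `X` on `S` (`setFlip S`)
changes expectations by the explicit factor `exp(-2 ∑_{x ∈ S, v ∼ x, v ∉ S} X_x X_v)`
(`flipExponent`): this is the change of variables behind Lupu 2016, Lemma 4.1 / Prop. 4.2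
(flipping the free field on a cluster `S` costs the exponential of the cross terms of the energy
between `S` and `Sᶜ`, "`∏ e^{-C(e) ψ_x ψ_y}`"), proved here by induction on `S` from the one-site
identity `IsInnovationSite.lintegral_comp_siteFlip` and the bookkeeping identity
`flipExponent_insert`. We give it for `ℝ≥0∞`-valued functionals (`lintegral_comp_setFlip`), as an
identity of measures (`map_setFlip_eq_withDensity`: the law of `R_S X` is the law of `X` with
density `exp(-2·flipExponent S)`), and for real functionals (`integral_comp_setFlip`).

References: T. Lupu, Ann. Probab. 44 (2016), §4, Lemma 4.1 and proof of Prop. 4.2 [`Lupu2016`].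
-/

noncomputable section

namespace Literature.Probability.LatticeModels

open _root_.MeasureTheory _root_.ProbabilityTheory Finset
open scoped ENNReal NNReal

variable {d : ℕ} {Ω : Type*} [MeasurableSpace Ω]

/-! ### Flipping the sign on a finite set of sites -/

/-- The sign flip of a configuration on the finite set `S`. [folklore] -/
def setFlip (S : Finset (Site d)) (φ : Site d → ℝ) : Site d → ℝ :=
  fun x => if x ∈ S then -φ x else φ x

/-- The **boundary interaction** of `S` in the configuration `φ`:
`∑_{x ∈ S} ∑_{v ∼ x, v ∉ S} φ_x φ_v` (each edge from `S` to `Sᶜ` counted once) — the cross terms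
of the Dirichlet energy between `S` and its complement, i.e. the exponent of the factor
`∏ e^{-C(e) ψ_x ψ_y}` over the edges leaving `S` in Lupu 2016, Lemma 4.1. [cite: Lupu2016, Lemma 4.1] -/
def flipExponent (S : Finset (Site d)) (φ : Site d → ℝ) : ℝ :=
  ∑ x ∈ S, ∑ v ∈ (zdGraph d).neighborFinset x, if v ∈ S then 0 else φ x * φ v

/-- Flipping the empty set does nothing. [folklore] -/
@[simp] theorem setFlip_empty (φ : Site d → ℝ) : setFlip ∅ φ = φ := by
  funext x; simp [setFlip]

/-- The empty set has no boundary interaction. [folklore] -/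
@[simp] theorem flipExponent_empty (φ : Site d → ℝ) : flipExponent ∅ φ = 0 := by
  simp [flipExponent]

/-- `siteFlip u` is an involution. [folklore] -/
theorem siteFlip_siteFlip (u : Site d) (φ : Site d → ℝ) : siteFlip u (siteFlip u φ) = φ := by
  funext x
  by_cases h : x = u
  · subst h; simp [siteFlip]
  · simp [siteFlip, h]

/-- Flipping `insert u S` is flipping `S` and then the site `u ∉ S`. [folklore] -/
theorem setFlip_insert {S : Finset (Site d)} {u : Site d} (hu : u ∉ S) (φ : Site d → ℝ) :
    setFlip (insert u S) φ = siteFlip u (setFlip S φ) := by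
  funext x
  by_cases h : x = u
  · subst h
    simp [setFlip, siteFlip, hu]
  · simp [setFlip, siteFlip, h]

/-- `setFlip S` is measurable. [folklore] -/
theorem measurable_setFlip (S : Finset (Site d)) : Measurable (setFlip (d := d) S) := by
  refine measurable_pi_lambda _ fun x => ?_
  by_cases h : x ∈ S
  · simp only [setFlip, h, if_true]; exact (measurable_pi_apply x).neg
  · simp only [setFlip, h, if_false]; exact measurable_pi_apply x

/-- `flipExponent S` is measurable. [folklore] -/
theorem measurable_flipExponent (S : Finset (Site d)) :
    Measurable (flipExponent (d := d) S) := by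
  refine Finset.measurable_sum _ fun x _ => Finset.measurable_sum _ fun v _ => ?_
  split_ifs
  · exact measurable_const
  · exact (measurable_pi_apply x).mul (measurable_pi_apply v)

/-- **The boundary interaction of `insert u S`** (`u ∉ S`):
`flipExponent (insert u S) φ = flipExponent S (R_u φ) + φ_u ∑_{v ∼ u} φ_v` — the identity
driving the induction from one-site flips to set flips (the edges between `u` and `S` change sign
under `R_u` and cancel against the same edges seen from `u`). [folklore] -/
theorem flipExponent_insert {S : Finset (Site d)} {u : Site d} (hu : u ∉ S) (φ : Site d → ℝ) :
    flipExponent (insert u S) φ =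
      flipExponent S (siteFlip u φ) + φ u * zdNeighborSum φ u := by
  classical
  have hvu : ∀ {x v : Site d}, v ∈ (zdGraph d).neighborFinset x → v ≠ x := fun hv h => by
    rw [SimpleGraph.mem_neighborFinset] at hv
    exact (h ▸ hv).ne rfl
  rw [flipExponent, Finset.sum_insert hu]
  -- the row of `u`: `v ∼ u` is never `u`
  have hrow_u : ∑ v ∈ (zdGraph d).neighborFinset u, (if v ∈ insert u S then 0 else φ u * φ v) =
      ∑ v ∈ (zdGraph d).neighborFinset u, if v ∈ S then 0 else φ u * φ v := by
    refine Finset.sum_congr rfl fun v hv => ?_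
    simp only [Finset.mem_insert, hvu hv, false_or]
  -- the rows of `x ∈ S`
  have hrow : ∀ x ∈ S, ∑ v ∈ (zdGraph d).neighborFinset x,
      (if v ∈ insert u S then 0 else φ x * φ v) =
      (∑ v ∈ (zdGraph d).neighborFinset x,
        if v ∈ S then 0 else siteFlip u φ x * siteFlip u φ v) +
        if u ∈ (zdGraph d).neighborFinset x then φ x * φ u else 0 := by
    intro x hx
    have hxu : x ≠ u := fun h => hu (h ▸ hx)
    rw [← Finset.sum_ite_eq' ((zdGraph d).neighborFinset x) u (fun _ => φ x * φ u),
      ← Finset.sum_add_distrib]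
    refine Finset.sum_congr rfl fun v _ => ?_
    by_cases hvS : v ∈ S
    · have hvu' : v ≠ u := fun h => hu (h ▸ hvS)
      simp [hvS, hvu']
    · by_cases hvu' : v = u
      · subst hvu'
        simp [siteFlip, hxu, hu]
      · simp [hvS, hvu', siteFlip, hxu]
  rw [hrow_u, Finset.sum_congr rfl hrow, Finset.sum_add_distrib, flipExponent]
  -- the edges between `u` and `S`, seen from `S` and from `u`
  have hsym : ∑ x ∈ S, (if u ∈ (zdGraph d).neighborFinset x then φ x * φ u else 0) =
      ∑ v ∈ (zdGraph d).neighborFinset u, if v ∈ S then φ u * φ v else 0 := by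
    rw [← Finset.sum_filter, ← Finset.sum_filter]
    refine Finset.sum_congr ?_ fun v _ => mul_comm _ _
    ext v
    simp only [Finset.mem_filter, SimpleGraph.mem_neighborFinset, (zdGraph d).adj_comm]
    tauto
  rw [hsym, zdNeighborSum, Finset.mul_sum]
  have hsplit : ∑ v ∈ (zdGraph d).neighborFinset u, φ u * φ v =
      (∑ v ∈ (zdGraph d).neighborFinset u, if v ∈ S then 0 else φ u * φ v) +
        ∑ v ∈ (zdGraph d).neighborFinset u, if v ∈ S then φ u * φ v else 0 := by
    rw [← Finset.sum_add_distrib]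
    refine Finset.sum_congr rfl fun v _ => ?_
    split_ifs <;> ring
  rw [hsplit]
  ring

/-- **Flipping the sign on a finite set** (`d ≥ 1`): if the centred Gaussian lattice field `X`
has the innovation property at every site of the finite set `S`, then for measurable `F ≥ 0`,
`E F(R_S X) = E[F(X) · exp(-2 ∑_{x ∈ S, v ∼ x, v ∉ S} X_x X_v)]` — the change of variables of
Lupu 2016, Lemma 4.1 / proof of Prop. 4.2 (flipping the free field on a cluster costs the
exponential of the energy cross terms), obtained by induction on `S` from the one-site flip
`lintegral_comp_siteFlip` and `flipExponent_insert`. [cite: Lupu2016, Lemma 4.1 and proof of Prop. 4.2] -/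
theorem lintegral_comp_setFlip {P : Measure Ω} {X : Site d → Ω → ℝ} (hd : 0 < d)
    (S : Finset (Site d)) (hX : ∀ u ∈ S, IsInnovationSite P X u)
    {F : (Site d → ℝ) → ℝ≥0∞} (hF : Measurable F) :
    ∫⁻ ω, F (setFlip S (X · ω)) ∂P =
      ∫⁻ ω, F (X · ω) * ENNReal.ofReal (Real.exp (-2 * flipExponent S (X · ω))) ∂P := by
  classical
  induction S using Finset.induction_on generalizing F with
  | empty => simp
  | @insert u S hu ih =>
    have hu' : IsInnovationSite P X u := hX u (Finset.mem_insert_self u S)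
    have hS : ∀ v ∈ S, IsInnovationSite P X v := fun v hv => hX v (Finset.mem_insert_of_mem hv)
    set wS : (Site d → ℝ) → ℝ≥0∞ := fun φ =>
      ENNReal.ofReal (Real.exp (-2 * flipExponent S φ)) with hwS
    have hwSm : Measurable wS := Measurable.ennreal_ofReal
      (Real.measurable_exp.comp (measurable_const.mul (measurable_flipExponent S)))
    set H : (Site d → ℝ) → ℝ≥0∞ := fun φ => F φ * wS (siteFlip u φ) with hH
    have hHm : Measurable H := hF.mul (hwSm.comp (measurable_siteFlip u))
    calc ∫⁻ ω, F (setFlip (insert u S) (X · ω)) ∂P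
        = ∫⁻ ω, (F ∘ siteFlip u) (setFlip S (X · ω)) ∂P := by
          simp only [setFlip_insert hu, Function.comp_apply]
      _ = ∫⁻ ω, (F ∘ siteFlip u) (X · ω) * wS (X · ω) ∂P := ih hS (hF.comp (measurable_siteFlip u))
      _ = ∫⁻ ω, H (siteFlip u (X · ω)) ∂P := by
          simp only [hH, Function.comp_apply, siteFlip_siteFlip]
      _ = ∫⁻ ω, H (X · ω) *
            ENNReal.ofReal (Real.exp (-2 * X u ω * zdNeighborSum (X · ω) u)) ∂P :=
          hu'.lintegral_comp_siteFlip hd hHm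
      _ = _ := by
          refine lintegral_congr fun ω => ?_
          simp only [hH, hwS]
          rw [mul_assoc, ← ENNReal.ofReal_mul (Real.exp_nonneg _), ← Real.exp_add,
            flipExponent_insert hu]
          congr 3
          simp only [siteFlip]
          ring

/-- The density `exp(-2 · flipExponent S)` as an `ℝ≥0∞`-valued function. [folklore] -/
def flipDensity (S : Finset (Site d)) (φ : Site d → ℝ) : ℝ≥0∞ :=
  ENNReal.ofReal (Real.exp (-2 * flipExponent S φ))

/-- `flipDensity S` is measurable. [folklore] -/
theorem measurable_flipDensity (S : Finset (Site d)) : Measurable (flipDensity (d := d) S) :=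
  Measurable.ennreal_ofReal (Real.measurable_exp.comp (measurable_const.mul (measurable_flipExponent S)))

/-- **The law of the flipped field is the law of the field with density `exp(-2·flipExponent S)`**
(`d ≥ 1`, innovation property at every site of `S`). [cite: Lupu2016, Lemma 4.1 and proof of Prop. 4.2] -/
theorem map_setFlip_eq_withDensity {P : Measure Ω} {X : Site d → Ω → ℝ} (hd : 0 < d)
    (S : Finset (Site d)) (hX : ∀ u ∈ S, IsInnovationSite P X u) (hm : ∀ x, Measurable (X x)) :
    P.map (fun ω => setFlip S (X · ω)) =
      (P.map fun ω => (X · ω)).withDensity (flipDensity S) := by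
  have hfield : Measurable fun ω => (X · ω) := measurable_pi_lambda _ hm
  have hsf : Measurable fun ω => setFlip S (X · ω) := (measurable_setFlip S).comp hfield
  ext B hB
  rw [Measure.map_apply hsf hB, withDensity_apply _ hB, ← lintegral_indicator_one (hsf hB)]
  have h1 : ∫⁻ ω, ((fun ω => setFlip S (X · ω)) ⁻¹' B).indicator (1 : Ω → ℝ≥0∞) ω ∂P =
      ∫⁻ ω, B.indicator (1 : (Site d → ℝ) → ℝ≥0∞) (setFlip S (X · ω)) ∂P :=
    lintegral_congr fun ω => rfl
  rw [h1, lintegral_comp_setFlip hd S hX (measurable_one.indicator hB), ← lintegral_indicator hB,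
    lintegral_map ((measurable_flipDensity S).indicator hB) hfield]
  refine lintegral_congr fun ω => ?_
  by_cases hφ : (X · ω) ∈ B
  · simp [hφ, flipDensity]
  · simp [hφ]

/-- **Flipping the sign on a finite set, real functionals** (`d ≥ 1`): for every real `F`
(a.e.-strongly measurable with respect to the law of the field),
`E F(R_S X) = E[F(X) · exp(-2 ∑_{x ∈ S, v ∼ x, v ∉ S} X_x X_v)]`.
[cite: Lupu2016, Lemma 4.1 and proof of Prop. 4.2] -/
theorem integral_comp_setFlip {P : Measure Ω} {X : Site d → Ω → ℝ} (hd : 0 < d)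
    (S : Finset (Site d)) (hX : ∀ u ∈ S, IsInnovationSite P X u) (hm : ∀ x, Measurable (X x))
    {F : (Site d → ℝ) → ℝ} (hF : StronglyMeasurable F) :
    ∫ ω, F (setFlip S (X · ω)) ∂P =
      ∫ ω, F (X · ω) * Real.exp (-2 * flipExponent S (X · ω)) ∂P := by
  have hfield : Measurable fun ω => (X · ω) := measurable_pi_lambda _ hm
  have hsf : Measurable fun ω => setFlip S (X · ω) := (measurable_setFlip S).comp hfield
  calc ∫ ω, F (setFlip S (X · ω)) ∂P
      = ∫ φ, F φ ∂P.map (fun ω => setFlip S (X · ω)) :=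
        (integral_map hsf.aemeasurable hF.aestronglyMeasurable).symm
    _ = ∫ φ, F φ ∂(P.map fun ω => (X · ω)).withDensity (flipDensity S) := by
        rw [map_setFlip_eq_withDensity hd S hX hm]
    _ = ∫ φ, (flipDensity S φ).toReal • F φ ∂P.map (fun ω => (X · ω)) :=
        integral_withDensity_eq_integral_toReal_smul (measurable_flipDensity S)
          (Filter.Eventually.of_forall fun φ => by simp [flipDensity]) F
    _ = ∫ ω, (flipDensity S (X · ω)).toReal • F (X · ω) ∂P := by
        refine integral_map hfield.aemeasurable ?_
        exact ((measurable_flipDensity S).ennreal_toReal.stronglyMeasurable.smul hF).aestronglyMeasurable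
    _ = _ := by
        refine integral_congr_ae (Filter.Eventually.of_forall fun ω => ?_)
        simp only [flipDensity, smul_eq_mul, ENNReal.toReal_ofReal (Real.exp_nonneg _)]
        ring

end Literature.Probability.LatticeModels
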